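import Mathlib.Analysis.Matrix.Order
import Mathlib.Analysis.Matrix.Spectrum
import Mathlib.Analysis.MeanInequalities
import Mathlib.Analysis.SpecialFunctions.Pow.NNReal
import HarnessLib

/-!
# The determinant–trace AM–GM inequality for positive semidefinite real matrices

For real symmetric positive semidefinite `N × N` matrices `A, B`,

`N · (det A · det B)^{1/N} ≤ Tr(A B)`,

in particular `N (det A)^{1/N} ≤ Tr A` (`B = 1`). This is the arithmetic–geometric mean
inequality for the (nonnegative) eigenvalues of `√A B √A` — equivalently of `C B Cᵀ` for any
factorisation `A = Cᵀ C` — and is the pointwise inequality at the heart of every proof of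
D. Serre's *Compensated Integrability* (Serre 2024, Appendix A, (24):
`(f det A)^{1/n} = det((S + D²θ)A)^{1/n} ≤ (1/n) Tr((S + D²θ)A)`; Serre 2018/2019 [10, 11] of
that paper), where it is integrated against a divergence-controlled tensor `A` and the Hessian of
a convex potential. Classical matrix analysis (Minkowski's determinant inequality is its
integrated sibling); Mathlib has the scalar weighted AM–GM (`Real.geom_mean_le_arith_mean_weighted`),
the spectral theorem (`Matrix.IsHermitian.det_eq_prod_eigenvalues`, `trace_eq_sum_eigenvalues`)
and the factorisation of nonnegative elements (`CStarAlgebra.nonneg_iff_eq_star_mul_self` under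
`open scoped MatrixOrder`), but not this inequality (`lean search 'det.*trace|geom_mean'`).

* `card_mul_det_rpow_le_trace` — `N (det A)^{1/N} ≤ Tr A` for `A ⪰ 0`;
* `card_mul_det_mul_det_rpow_le_trace_mul` — `N (det A det B)^{1/N} ≤ Tr(A B)` for `A, B ⪰ 0`;
* `det_mul_det_rpow_le_trace_mul_div` — the same as `(det A det B)^{1/N} ≤ Tr(A B) / N`.

Over `ℝ` only (real `rpow`; the tensors of compensated integrability are real symmetric).

## References

* D. Serre, *Compensated integrability on tori; a priori estimate for space-periodic gas flows*,
  C. R. Math. Acad. Sci. Paris 362 (2024) 1425–1444, Appendix A, (24). [Serre2024]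
* R. Bhatia, *Matrix Analysis*, Springer GTM 169 (1997), §II (AM–GM for eigenvalues). [folklore]
-/

open Matrix Finset
open scoped MatrixOrder

namespace Literature.LinearAlgebra.Matrix

variable {n : Type*} [Fintype n] [DecidableEq n]

/-- **AM–GM for the eigenvalues of a positive semidefinite real matrix**:
`N (det A)^{1/N} ≤ Tr A`, `N` the size (`det A = ∏ λᵢ`, `Tr A = ∑ λᵢ`, `λᵢ ≥ 0`, and the
weighted AM–GM inequality with weights `1/N`). For the empty matrix both sides vanish.
[folklore] -/
theorem card_mul_det_rpow_le_trace {A : Matrix n n ℝ} (hA : A.PosSemidef) :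
    (Fintype.card n : ℝ) * A.det ^ (1 / (Fintype.card n : ℝ)) ≤ A.trace := by
  rcases isEmpty_or_nonempty n with hn | hn
  · simp [Matrix.trace]
  have hN : (0 : ℝ) < Fintype.card n := Nat.cast_pos.2 Fintype.card_pos
  have hdet : A.det = ∏ i, hA.1.eigenvalues i := by
    simpa using hA.1.det_eq_prod_eigenvalues
  have htr : A.trace = ∑ i, hA.1.eigenvalues i := by
    simpa using hA.1.trace_eq_sum_eigenvalues
  have hnn : ∀ i ∈ (univ : Finset n), 0 ≤ hA.1.eigenvalues i := fun i _ => hA.eigenvalues_nonneg i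
  have hw : ∑ _i ∈ (univ : Finset n), (1 / (Fintype.card n : ℝ)) = 1 := by
    rw [sum_const, card_univ, nsmul_eq_mul, mul_one_div_cancel hN.ne']
  have key := Real.geom_mean_le_arith_mean_weighted univ (fun _ => 1 / (Fintype.card n : ℝ))
    (fun i => hA.1.eigenvalues i) (fun _ _ => by positivity) hw hnn
  rw [Real.finsetProd_rpow univ _ hnn, ← mul_sum] at key
  rw [hdet, htr]
  have h := mul_le_mul_of_nonneg_left key hN.le
  rwa [← mul_assoc, mul_one_div_cancel hN.ne', one_mul] at h

/-- **Determinant–trace AM–GM** (the pointwise inequality of compensated integrability,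
Serre 2024 (24)): for positive semidefinite real `A, B`, `N (det A · det B)^{1/N} ≤ Tr(A B)`.
Proof: factor `A = Cᵀ C` (`CStarAlgebra.nonneg_iff_eq_star_mul_self`); then
`Tr(A B) = Tr(C B Cᵀ)` with `C B Cᵀ ⪰ 0` of determinant `det A · det B`, and apply
`card_mul_det_rpow_le_trace`. [cite: Serre2024, Appendix A (24)] -/
theorem card_mul_det_mul_det_rpow_le_trace_mul {A B : Matrix n n ℝ} (hA : A.PosSemidef)
    (hB : B.PosSemidef) :
    (Fintype.card n : ℝ) * (A.det * B.det) ^ (1 / (Fintype.card n : ℝ)) ≤ (A * B).trace := by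
  obtain ⟨C, rfl⟩ := CStarAlgebra.nonneg_iff_eq_star_mul_self.mp hA.nonneg
  have hP : (C * B * star C).PosSemidef := by
    rw [star_eq_conjTranspose]
    exact hB.mul_mul_conjTranspose_same C
  have hdet : (C * B * star C).det = (star C * C).det * B.det := by
    rw [det_mul, det_mul, det_mul, star_eq_conjTranspose, det_conjTranspose, star_trivial]
    ring
  have htr : (C * B * star C).trace = (star C * C * B).trace := trace_mul_cycle C B (star C)
  rw [← hdet, ← htr]
  exact card_mul_det_rpow_le_trace hP

/-- The determinant–trace AM–GM in the form `(det A · det B)^{1/N} ≤ Tr(A B) / N` (`N ≥ 1`).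
[cite: Serre2024, Appendix A (24)] -/
theorem det_mul_det_rpow_le_trace_mul_div [Nonempty n] {A B : Matrix n n ℝ} (hA : A.PosSemidef)
    (hB : B.PosSemidef) :
    (A.det * B.det) ^ (1 / (Fintype.card n : ℝ)) ≤ (A * B).trace / Fintype.card n := by
  have hN : (0 : ℝ) < Fintype.card n := Nat.cast_pos.2 Fintype.card_pos
  rw [le_div_iff₀ hN, mul_comm]
  exact card_mul_det_mul_det_rpow_le_trace_mul hA hB

end Literature.LinearAlgebra.Matrix
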